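import Literature.Analysis.FluidPDE.ElgindiEllipticClassicalSolution
import Literature.Analysis.Distribution.DivFormRegularity
import Literature.Analysis.Distribution.EllipticRegularityProofs
import HarnessLib

/-!
# Smooth representatives of distributional solutions of `LΨ = F` on the strip
([Elgindi2021] §7.1 Proposition 7.1, "standard regularity theory", for limits of solutions)

Topic `Literature/Analysis/FluidPDE`. Proof file (everything proved, no definitions, no named
facts) on the proof path of the named fact
`Literature.Analysis.FluidPDE.Elgindi.ElgindiGhoulMasmoudi2021_stabilityCore`
(`ElgindiStabilityDecomposition.lean`). T. M. Elgindi, Ann. of Math. 194 (2021) =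
arXiv:1904.04795, §7.1 Proposition 7.1 (p. 19), via Folland 1995 Cor. (6.34) as vendored in
`Literature.Analysis.Distribution.DivFormRegularity`.

If `u ∈ L¹_loc(strip)` satisfies `∫∫_strip u·ᵗL(Φ) = ∫∫_strip F·Φ` for all smooth `Φ` compactly
supported in the open strip, with `F ∈ C^∞(strip)`, then `u` agrees a.e. on the strip with a
function smooth on the strip (`exists_smooth_rep_of_distrib`): the regularity input for solutions
obtained as limits (data that are not compactly supported).
-/

noncomputable section

open MeasureTheory Set Function Real Filter
open _root_.Topology
open scoped ContDiff

namespace Literature.Analysis.FluidPDE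

namespace Elgindi

open Literature.Analysis.Distribution

/-- `u/w` is locally integrable on the strip when `u` is (`w` the regularity weight). [folklore] -/
theorem locallyIntegrableOn_div_regWeight' (α : ℝ) {u : ℝ × ℝ → ℝ} (hu : LocallyIntegrableOn u strip volume) :
    LocallyIntegrableOn (fun x => u x / regWeight α x) strip volume := by
  rw [locallyIntegrableOn_iff isOpen_strip.isLocallyClosed] at hu ⊢
  intro k hk hkc
  have h2 : IntegrableOn u k volume := hu k hk hkc
  have h3 : ContinuousOn (fun x => (regWeight α x)⁻¹) k :=
    ((contDiffOn_regWeight α (n := 0)).continuousOn.mono hk).inv₀ fun x hx => (regWeight_pos α (hk hx)).ne'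
  have := h2.mul_continuousOn h3 hkc
  simpa [div_eq_mul_inv] using this

/-- **Local smoothness of a distributional solution** of `Lu = F`, `F ∈ C^∞(strip)`. [cite: Elgindi2021, §7.1 Proposition 7.1 (p. 19 of arXiv:1904.04795), via Folland 1995 Cor. (6.34)] -/
theorem exists_local_smooth_rep_of_distrib {α : ℝ} (hα : 0 < α) {F : ℝ × ℝ → ℝ} (hF : ContDiffOn ℝ ∞ F strip)
    {u : ℝ × ℝ → ℝ} (hu : LocallyIntegrableOn u strip volume)
    (hsol : ∀ Φ : ℝ → ℝ → ℝ, (∀ n : ℕ, ContDiff ℝ n (uncurry Φ)) → HasCompactSupport (uncurry Φ) → tsupport (uncurry Φ) ⊆ strip →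
      ∫ p in strip, u p * transposeOp α Φ p = ∫ p in strip, F p * Φ p.1 p.2)
    {x₀ : ℝ × ℝ} (hx₀ : x₀ ∈ strip) :
    ∃ V : Set (ℝ × ℝ), IsOpen V ∧ x₀ ∈ V ∧ V ⊆ strip ∧
      ∃ g : ℝ × ℝ → ℝ, ContDiffOn ℝ ∞ g V ∧ ∀ᵐ x ∂(volume : Measure (ℝ × ℝ)), x ∈ V → u x = g x := by
  have hG : ContDiffOn ℝ ∞ (fun x => -F x) strip := hF.neg
  -- the very weak divergence-form identity for `u/w`
  have hweak : ∀ φ : ℝ × ℝ → ℝ, ContDiff ℝ ∞ φ → HasCompactSupport φ → tsupport φ ⊆ strip →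
      ∫ x, (fun x => u x / regWeight α x) x *
        ((∑ i, ∑ j, fderiv ℝ (fun y => divCoeff α i j y * fderiv ℝ φ y (stdBasis i)) x (stdBasis j)) - divZero α x * φ x) =
      ∫ x, (fun x => -F x) x * φ x := by
    intro φ hφ hφs hφS
    show ∫ x, u x / regWeight α x * divBracket α φ x = ∫ x, -F x * φ x
    set Φ : ℝ → ℝ → ℝ := fun R θ => φ (R, θ) with hΦ
    have euc : uncurry Φ = φ := by funext p; rfl
    have hΦn : ∀ n : ℕ, ContDiff ℝ n (uncurry Φ) := fun n => by rw [euc]; exact hφ.of_le (by exact_mod_cast (le_top : (n : ℕ∞) ≤ ⊤))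
    have hΦs : HasCompactSupport (uncurry Φ) := by rw [euc]; exact hφs
    have hΦS : tsupport (uncurry Φ) ⊆ strip := by rw [euc]; exact hφS
    have l0 : ∀ x, x ∉ strip → u x / regWeight α x * divBracket α φ x = 0 := fun x hx => by
      rw [divBracket_eq_zero_of_notMem α (fun h => hx (hφS h)), mul_zero]
    have r0 : ∀ x, x ∉ strip → -F x * φ x = 0 := fun x hx => by
      rw [show φ x = 0 from image_eq_zero_of_notMem_tsupport fun h => hx (hφS h), mul_zero]
    rw [← setIntegral_eq_integral_of_forall_compl_eq_zero (s := strip) (fun x hx => l0 x hx),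
      ← setIntegral_eq_integral_of_forall_compl_eq_zero (s := strip) (fun x hx => r0 x hx)]
    have e1 : ∫ x in strip, u x / regWeight α x * divBracket α φ x = -∫ x in strip, u x * transposeOp α Φ x := by
      rw [← MeasureTheory.integral_neg]
      refine setIntegral_congr_fun measurableSet_strip fun x hx => ?_
      have hφ2 : ContDiff ℝ 2 φ := by simpa [euc] using hΦn 2
      rw [divBracket_eq_neg_weight_mul_transposeOp hα.ne' hφ2 hx]
      have hw0 : regWeight α x ≠ 0 := (regWeight_pos α hx).ne'
      field_simp
      rfl
    rw [e1, hsol Φ hΦn hΦs hΦS, ← MeasureTheory.integral_neg]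
    refine setIntegral_congr_fun measurableSet_strip fun x _ => ?_
    simp only [hΦ]; ring
  obtain ⟨V, hV, hxV, hVS, g, hg, hae⟩ := exists_contDiffOn_ae_eq_of_divForm_weak (μ := (volume : Measure (ℝ × ℝ))) (b := stdBasis)
    Folland1995_cor634_holds isOpen_strip (a := divCoeff α) (contDiffOn_divCoeff α)
    (fun x hx v hv => divCoeff_pos hα.ne' hx v hv) (contDiffOn_divZero α) hG (locallyIntegrableOn_div_regWeight' α hu) hweak hx₀
  refine ⟨V, hV, hxV, hVS, fun x => regWeight α x * g x, ((contDiffOn_regWeight α).mono hVS).mul hg, ?_⟩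
  filter_upwards [hae] with x hx hxV'
  have h := hx hxV'
  have hw0 : regWeight α x ≠ 0 := (regWeight_pos α (hVS hxV')).ne'
  field_simp at h
  linarith [h]

/-- **A smooth representative on the whole strip** of a distributional solution of `Lu = F`. [cite: Elgindi2021, §7.1 Proposition 7.1 (p. 19 of arXiv:1904.04795)] -/
theorem exists_smooth_rep_of_distrib {α : ℝ} (hα : 0 < α) {F : ℝ × ℝ → ℝ} (hF : ContDiffOn ℝ ∞ F strip)
    {u : ℝ × ℝ → ℝ} (hu : LocallyIntegrableOn u strip volume)
    (hsol : ∀ Φ : ℝ → ℝ → ℝ, (∀ n : ℕ, ContDiff ℝ n (uncurry Φ)) → HasCompactSupport (uncurry Φ) → tsupport (uncurry Φ) ⊆ strip →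
      ∫ p in strip, u p * transposeOp α Φ p = ∫ p in strip, F p * Φ p.1 p.2) :
    ∃ Ψ : ℝ × ℝ → ℝ, ContDiffOn ℝ ∞ Ψ strip ∧ ∀ᵐ y ∂(volume : Measure (ℝ × ℝ)), y ∈ strip → u y = Ψ y :=
  exists_smooth_rep_of_local isOpen_strip fun _ hx => exists_local_smooth_rep_of_distrib hα hF hu hsol hx

/-- The smooth representative solves `LΨ = F` classically on the strip. [folklore] -/
theorem ellipticOp_rep_of_distrib {α : ℝ} {F : ℝ × ℝ → ℝ} (hF : ContDiffOn ℝ ∞ F strip)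
    {u : ℝ × ℝ → ℝ}
    (hsol : ∀ Φ : ℝ → ℝ → ℝ, (∀ n : ℕ, ContDiff ℝ n (uncurry Φ)) → HasCompactSupport (uncurry Φ) → tsupport (uncurry Φ) ⊆ strip →
      ∫ p in strip, u p * transposeOp α Φ p = ∫ p in strip, F p * Φ p.1 p.2)
    {Ψ : ℝ × ℝ → ℝ} (hΨ : ContDiffOn ℝ ∞ Ψ strip) (hae : ∀ᵐ y ∂(volume : Measure (ℝ × ℝ)), y ∈ strip → u y = Ψ y) :
    ∀ p ∈ strip, ellipticOp α (fun R θ => Ψ (R, θ)) p.1 p.2 = F p := by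
  set Ψc : ℝ → ℝ → ℝ := fun R θ => Ψ (R, θ) with hΨc
  set g : ℝ × ℝ → ℝ := fun p => ellipticOp α Ψc p.1 p.2 - F p with hg
  -- continuity of `L(Ψ)` on the strip (locally it is `L` of a compactly supported smooth function)
  have hLc : ContinuousOn (fun p : ℝ × ℝ => ellipticOp α Ψc p.1 p.2) strip := by
    intro p hp
    obtain ⟨W, Ψt, hW, hpW, hWS, hΨt, hΨts, hΨtS, hEq⟩ := exists_test_eqOn hΨ isCompact_singleton (singleton_subset_iff.2 hp)
    have hpW' : p ∈ W := hpW (mem_singleton p)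
    set Ψtc : ℝ → ℝ → ℝ := fun R θ => Ψt (R, θ) with hΨtc
    have eut : uncurry Ψtc = Ψt := by funext q; rfl
    have hΨtn : ∀ n : ℕ, ContDiff ℝ n (uncurry Ψtc) := fun n => by
      rw [eut]; exact hΨt.of_le (by exact_mod_cast (le_top : (n : ℕ∞) ≤ ⊤))
    have hΨts' : HasCompactSupport (uncurry Ψtc) := by rw [eut]; exact hΨts
    have hΨtS' : tsupport (uncurry Ψtc) ⊆ strip := by rw [eut]; exact hΨtS
    have hc := continuousOn_ellipticOp_test α hΨtn hΨts' hΨtS'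
    have heq : ∀ q ∈ W, ellipticOp α Ψtc q.1 q.2 = ellipticOp α Ψc q.1 q.2 := fun q hq =>
      eqOn_ellipticOp α hW (fun r hr => by show Ψt (r.1, r.2) = Ψ (r.1, r.2); exact hEq hr) hq
    have h1 : ContinuousAt (fun q : ℝ × ℝ => ellipticOp α Ψtc q.1 q.2) p := (hc p hp).continuousAt (isOpen_strip.mem_nhds hp)
    have h2 : (fun q : ℝ × ℝ => ellipticOp α Ψtc q.1 q.2) =ᶠ[𝓝 p] fun q => ellipticOp α Ψc q.1 q.2 := by
      filter_upwards [hW.mem_nhds hpW'] with q hq using heq q hq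
    exact (h1.congr h2).continuousWithinAt
  have hgc : ContinuousOn g strip := hLc.sub hF.continuousOn
  -- the pairing with every test function vanishes
  have hpair : ∀ φ : ℝ × ℝ → ℝ, ContDiff ℝ ∞ φ → HasCompactSupport φ → tsupport φ ⊆ strip →
      ∫ x, φ x • g x ∂(volume : Measure (ℝ × ℝ)) = 0 := by
    intro φ hφ hφs hφS
    set Φ : ℝ → ℝ → ℝ := fun R θ => φ (R, θ) with hΦ
    have euc : uncurry Φ = φ := by funext q; rfl
    have hΦn : ∀ n : ℕ, ContDiff ℝ n (uncurry Φ) := fun n => by rw [euc]; exact hφ.of_le (by exact_mod_cast (le_top : (n : ℕ∞) ≤ ⊤))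
    have hΦs : HasCompactSupport (uncurry Φ) := by rw [euc]; exact hφs
    have hΦS : tsupport (uncurry Φ) ⊆ strip := by rw [euc]; exact hφS
    -- localise `Ψ` near the support of `φ`
    obtain ⟨W, Ψt, hW, hKW, hWS, hΨt, hΨts, hΨtS, hEq⟩ := exists_test_eqOn hΨ hφs (by rw [← euc]; exact hΦS)
    set Ψtc : ℝ → ℝ → ℝ := fun R θ => Ψt (R, θ) with hΨtc
    have eut : uncurry Ψtc = Ψt := by funext q; rfl
    have hΨtn : ∀ n : ℕ, ContDiff ℝ n (uncurry Ψtc) := fun n => by rw [eut]; exact hΨt.of_le (by exact_mod_cast (le_top : (n : ℕ∞) ≤ ⊤))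
    have hΨts' : HasCompactSupport (uncurry Ψtc) := by rw [eut]; exact hΨts
    have hΨtS' : tsupport (uncurry Ψtc) ⊆ strip := by rw [eut]; exact hΨtS
    have heqL : ∀ q ∈ W, ellipticOp α Ψtc q.1 q.2 = ellipticOp α Ψc q.1 q.2 := fun q hq =>
      eqOn_ellipticOp α hW (fun r hr => by show Ψt (r.1, r.2) = Ψ (r.1, r.2); exact hEq hr) hq
    -- `∫ φ g = ∫_strip (LΨ)Φ − ∫_strip fΦ`
    have e0 : ∫ x, φ x • g x ∂(volume : Measure (ℝ × ℝ)) = ∫ x in strip, φ x * g x := by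
      rw [← setIntegral_eq_integral_of_forall_compl_eq_zero (s := strip) fun x hx => ?_]
      · rfl
      · rw [show φ x = 0 from image_eq_zero_of_notMem_tsupport fun h => hx (hφS h), zero_smul]
    have e1 : ∫ x in strip, φ x * g x = ∫ x in strip, (ellipticOp α Ψtc x.1 x.2 * Φ x.1 x.2 - F x * Φ x.1 x.2) := by
      refine setIntegral_congr_fun measurableSet_strip fun x hx => ?_
      simp only [hg]
      by_cases hxs : x ∈ tsupport φ
      · rw [heqL x (hKW hxs)]; simp only [hΦ]; ring
      · rw [show φ x = 0 from image_eq_zero_of_notMem_tsupport hxs]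
        simp only [hΦ]
        rw [show φ (x.1, x.2) = 0 from image_eq_zero_of_notMem_tsupport hxs]; ring
    have cL : Continuous fun x : ℝ × ℝ => ellipticOp α Ψtc x.1 x.2 * Φ x.1 x.2 := by
      -- equals the smooth representative times `Φ` everywhere (off the strip `Φ = 0`)
      obtain ⟨χ₁, h1n, h1s, h1pos, h10, hcos1⟩ := exists_profile_of_test hΨtn hΨts' hΨtS'
      obtain ⟨gF, hgF⟩ : ∃ gF : ℝ → ℝ → ℝ, gF = fun R θ => -α ^ 2 * R ^ 2 * dz (dz Ψtc) R θ - α * (5 + α) * R * dz Ψtc R θ -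
          dθ (dθ Ψtc) R θ + (Real.cos θ * χ₁ R θ + Real.sin θ * dθ χ₁ R θ) - 6 * Ψtc R θ := ⟨_, rfl⟩
      have heq := ellipticOp_eq_smoothRep α hcos1.symm hgF (h1n 2)
      have hc : Continuous (uncurry gF) := (contDiff_smoothRep α hcos1.symm hgF (n := 0) (by exact_mod_cast h1n 2)).continuous
      have e : (fun x : ℝ × ℝ => ellipticOp α Ψtc x.1 x.2 * Φ x.1 x.2) = fun x => uncurry gF x * Φ x.1 x.2 := by
        funext x
        by_cases hx : x ∈ strip
        · rw [heq x hx]; rfl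
        · have : Φ x.1 x.2 = 0 := image_eq_zero_of_notMem_tsupport (f := uncurry Φ) fun h => hx (hΦS h)
          rw [this, mul_zero, mul_zero]
      rw [e]; exact hc.mul (hΦn 0).continuous
    have iL : Integrable fun x : ℝ × ℝ => ellipticOp α Ψtc x.1 x.2 * Φ x.1 x.2 := cL.integrable_of_hasCompactSupport hΦs.mul_left
    have iF : Integrable fun x : ℝ × ℝ => F x * Φ x.1 x.2 := by
      have hsm : ContDiff ℝ ∞ fun x : ℝ × ℝ => φ x * F x :=
        Literature.Analysis.Distribution.contDiff_mul_of_tsupport_subset isOpen_strip hφ hφS hF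
      have hc : Continuous fun x : ℝ × ℝ => F x * Φ x.1 x.2 := by
        have e : (fun x : ℝ × ℝ => F x * Φ x.1 x.2) = fun x => φ x * F x := by funext x; simp only [hΦ]; ring
        rw [e]; exact hsm.continuous
      exact hc.integrable_of_hasCompactSupport hΦs.mul_left
    rw [e0, e1, integral_sub iL.integrableOn iF.integrableOn, integral_ellipticOp_mul_test α hΨtn hΨts' hΨtS' hΦn hΦs hΦS]
    -- `∫ Ψ̃ ᵗLΦ = ∫ u ᵗLΦ = ∫ F Φ`
    have e2 : ∫ x in strip, Ψtc x.1 x.2 * transposeOp α Φ x = ∫ x in strip, u x * transposeOp α Φ x := by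
      refine integral_congr_ae ?_
      have hae' : ∀ᵐ y ∂(volume.restrict strip), u y = Ψ y := (ae_restrict_iff' measurableSet_strip).2 hae
      filter_upwards [hae'] with x hx
      by_cases hxs : x ∈ tsupport φ
      · show Ψt (x.1, x.2) * _ = _
        rw [hEq (hKW hxs), hx]
      · rw [transposeOp_eq_zero_of_notMem α (by rw [euc]; exact hxs), mul_zero, mul_zero]
    rw [e2, hsol Φ hΦn hΦs hΦS, sub_self]
  -- fundamental lemma and continuity
  have hae0 := isOpen_strip.ae_eq_zero_of_integral_contDiff_smul_eq_zero (hgc.locallyIntegrableOn measurableSet_strip) hpair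
  have hEq0 : EqOn g 0 strip := by
    refine Measure.eqOn_open_of_ae_eq (μ := (volume : Measure (ℝ × ℝ))) ?_ isOpen_strip hgc continuousOn_const
    exact (ae_restrict_iff' measurableSet_strip).2 hae0
  intro p hp
  have := hEq0 hp
  simp only [hg, Pi.zero_apply, sub_eq_zero] at this
  exact this

end Elgindi

end Literature.Analysis.FluidPDE
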